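import Summits.BirchSwinnertonDyer.BirchSwinnertonDyer.Theorems.ByReductionTypeAtTwoRankOneAtTwoBigImageOddLocalOneDoorKolyvaginExactBridgeSupply
import Summits.BirchSwinnertonDyer.BirchSwinnertonDyer.Theorems.ByReductionTypeAtTwoRankOneAtTwoBigImageOddLocalOneDoorAnalyticAssembly
import Literature.NumberTheory.EllipticCurves.HeegnerHypothesisKroneckerProofs
import Literature.NumberTheory.EllipticCurves.NonEisensteinPrimeOfSurjective
import HarnessLib

/-!
# Route ByReductionTypeAtTwo, crux `RankOneAtTwoBigImageOddLocal` (stmt-BirchSwinnertonDyer-23715):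
# the line's E-side conjecture `DoorIndexLawFullAtTwo` (AN-28) is DOWNSTREAM of the K-side inputs

Width prover seat `bsd-line-fkl-p2` g7 (2026-08-28), sequel of `…OneDoorKolyvaginExactBridgeSupply.lean` (p622543); `--supports
stmt-BirchSwinnertonDyer-23715`.  THEOREMS ONLY; nothing asserted; BSD is not proved by any of this.

The load-bearing stub of the line of record `one_door_analytic` is the E-side conjecture `DoorIndexLawFullAtTwo` (AN-28: at EVERY
door-admissible Heegner field with `L(E^{(d_K)},1) ≠ 0` and every odd-constant datum, the Heegner point has an exact `2`-divisibility
exponent `m` with `2m + [Δ<0] = s_E + s_d + t + 2s`).  The lead's per-datum kernel iff `bsdp_two_iff_doorLawFull_at` (p615533) says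
that, modulo PRINT and `BSD(Wd, 2)` of the twin, this identity at ONE datum is `BSD(W, 2)` — which does not depend on the door.  Hence
ANY source of `BSD(W, 2)` on the slice proves AN-28 at ALL doors.  The K-side bridge
(`rankOneAtTwoBigImageOddLocal_of_kolyvaginExactAtTwo_of_kolyvaginConjecture`, p622543) is such a source, so:

* `satisfiesHeegnerHypothesis_of_doorAdmissible` — a door-admissible `d_K` satisfies the Heegner hypothesis for `N_W` (`d_K ≡ 1 (8)`
  splits `2`; `(d_K/ℓ) = 1` at the odd bad `ℓ`, which are exactly the odd `ℓ ∣ N_W`; decomposition law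
  `satisfiesHeegnerHypothesis_iff_kronecker`).
* the lead's `doorIndexLawFullAtTwo_of_crux` (`…OneDoorAnalyticAssembly.lean` APPEND, p620120: `S_pub → S_rankZeroTwin →
  RankOneAtTwoBigImageOddLocal → DoorIndexLawFullAtTwo`, the `→` direction of the iff at every door) is the E-side half; composing
  it with the K-side bridge gives `doorIndexLawFullAtTwo_of_kolyvaginExactAtTwo_of_kolyvaginConjecture` — **AN-28 ⟸ PRINT (GZ, Kolyvagin,
  GZK, modularity as a newform, Hoffstein–Luo, Milne 1972) + `KolyvaginExactAtTwo` (crux 22137 of route GenusKolyvaginAtTwo) + Kolyvagin's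
  conjecture at `2` on the slice's doors + `S_manin` + `S_rankZeroTwin`** (and `…_of_rankZero_cruxes` with the four route items BY NAME).

Reading for the planner-of-record: the two open conjectures named for 23715 are ORDERED — the K-side pair (22137, Kolyvagin's
conjecture at `2`) implies the E-side AN-28 (modulo the same PRINT/Manin/rank-`0` inputs), through `BSD(W, 2)` itself.  Nothing here
is asserted; every published input is an explicit binder.

References: [GrossZagier1986] Thm. I.6.3, V.§2; [GrossLMS1991] §2 (2.2), §4; [McCallumLMS1991] §5; [Milne1972ArithmeticAV] §1 Thm. 1;
[Miller2011LMS] Def. 1.1; [Kramer1981] Prop. 3.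
-/

set_option autoImplicit false
-- the Theorems namespace of this sub repeats the summit name by design (D-0017 nested layout)
set_option linter.dupNamespace false

noncomputable section

open scoped Classical

namespace Summit.BirchSwinnertonDyer.BirchSwinnertonDyer.Theorems.RankOneAtTwoOneDoor

open WeierstrassCurve NumberField Literature.NumberTheory.EllipticCurves Literature.NumberTheory.EllipticCurves.ModularForms
  Literature.NumberTheory.EllipticCurves.Rank1Residual
  Literature.NumberTheory.EllipticCurves.KrizLi2019
  Summit.BirchSwinnertonDyer.Rank1Residual
  Summit.BirchSwinnertonDyer.Rank1Residual.F1Sign2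
  Summit.BirchSwinnertonDyer.Rank1Residual.F1Sign2.TranspositionDoor
  Summit.BirchSwinnertonDyer.BirchSwinnertonDyer.Theses.ByReductionTypeAtTwo
open Summit.BirchSwinnertonDyer.BirchSwinnertonDyer.Theses.GenusKolyvaginAtTwo

/-! ### §1 Door-admissible ⇒ Heegner hypothesis -/

/-- **A door-admissible discriminant satisfies the Heegner hypothesis** for the conductor of `W`: `d_K ≡ 1 (mod 8)` makes `2` split,
and at an odd `ℓ ∣ N_W` the curve has bad reduction (`not_dvd_conductorNorm_of_hasGoodReductionAtPrime`), so `(d_K/ℓ) = 1` by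
admissibility; conclude by the decomposition law `satisfiesHeegnerHypothesis_iff_kronecker`. [cite: Gross1984, §3 (Heegner hypothesis)] -/
theorem satisfiesHeegnerHypothesis_of_doorAdmissible (W : WeierstrassCurve ℚ) [W.IsElliptic] [W.IsGloballyMinimal]
    (K : Type) [Field K] [NumberField K] (hK : IsImaginaryQuadratic K) (hadm : DoorAdmissible W (NumberField.discr K)) :
    SatisfiesHeegnerHypothesis (W.conductorNorm ℤ) K := by
  rw [satisfiesHeegnerHypothesis_iff_kronecker (W.conductorNorm ℤ) K hK.1]
  intro p hp hpN
  refine ⟨fun _ => hadm.2.2.1, fun hp2 => hadm.2.2.2.2 p hp hp2 fun hF hgood => ?_⟩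
  haveI := hF
  exact not_dvd_conductorNorm_of_hasGoodReductionAtPrime W hgood hpN

/-! ### §2 AN-28 from the K-side inputs -/

/-- **AN-28 ⟸ the K-side pair.**  `DoorIndexLawFullAtTwo` from: PRINT — Gross–Zagier (`hGZ`), Kolyvagin (`hKo`), GZK (`hGZK`),
modularity as a newform (`hnf`), Hoffstein–Luo 1997 (`hHL`), Milne 1972 any-model (`hMilneC`); route GenusKolyvaginAtTwo's crux
`KolyvaginExactAtTwo` (`hX`, stmt-22137); `S_manin` (`hMan`); Kolyvagin's conjecture at `2` in derived-point form on the slice's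
Kolyvagin-admissible doors (`hKC`); rank-`0` `BSD₂` of non-CM curves (`hZ`).  Composition of
`rankOneAtTwoBigImageOddLocal_of_kolyvaginExactAtTwo_of_kolyvaginConjecture` (p622543) with the lead's `doorIndexLawFullAtTwo_of_crux`
(p620120), whose `S_pub` is assembled from the binders and the tree theorem `heegnerPointComplex_mem_range_map_holds`.
BSD is not proved by this: conditional by design. [cite: GrossLMS1991, §2 Conj. (2.2) and §4] [cite: McCallumLMS1991, §5] -/
theorem doorIndexLawFullAtTwo_of_kolyvaginExactAtTwo_of_kolyvaginConjecture
    (hGZ : ∀ (N : ℕ) [NeZero N] (W : WeierstrassCurve ℚ) (K : Type) [Field K] [NumberField K], gross_zagier N W K)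
    (hKo : ∀ (N : ℕ) [NeZero N] (W : WeierstrassCurve ℚ) (K : Type) [Field K] [NumberField K], kolyvagin N W K)
    (hGZK : rank_eq_analyticRank_of_analyticRank_le_one) (hnf : exists_isNewformOf)
    (hHL : HoffsteinLuo1997_exists_twist_L_one_ne_zero) (hMilneC : Milne1972.bsdQuotient_baseChange_quadratic_anyModel)
    (hX : KolyvaginExactAtTwo) (hMan : S_manin)
    (hKC : ∀ (W : WeierstrassCurve ℚ) [W.IsElliptic] [W.IsGloballyMinimal] [NeZero (W.conductorNorm ℤ)],
      ¬ W.HasCM → (∀ n : ℕ, W.HasSurjectiveModNGaloisRep ((2 ^ n : ℕ) : ℤ)) → Odd W.tamagawaProduct → W.analyticRank = 1 →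
      ∀ (K : Type) [Field K] [NumberField K], IsImaginaryQuadratic K → Odd (NumberField.discr K) →
        NumberField.discr K ≠ -3 → SatisfiesHeegnerHypothesis (W.conductorNorm ℤ) K →
        ¬ IsSquare ((NumberField.discr K : ℚ) * -|W.Δ|) → ¬ IsSquare ((NumberField.discr K : ℚ) * (-(2 * |W.Δ|))) →
        ∀ (Dt : ModularParametrizationData W (W.conductorNorm ℤ)) (β : ℤ) (ι : K →+* ℂ) (d₁ : KolyvaginHeegnerData Dt β ι 1),
          Odd Dt.c → ¬ IsOfFinAddOrder d₁.derivedPoint →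
          ∃ (n : ℕ) (d : KolyvaginHeegnerData Dt β ι n), Squarefree n ∧
            (∀ ℓ ∈ n.primeFactors, Zhang2014.IsKolyvaginPrime (W.conductorNorm ℤ) W K 2 ℓ) ∧
            ¬ ∃ Q : (W.baseChange (ringClassField K ι n)).toAffine.Point, (2 : ℤ) • Q = d.derivedPoint)
    (hZ : S_rankZeroTwin) : DoorIndexLawFullAtTwo :=
  doorIndexLawFullAtTwo_of_crux
    ⟨fun N _ W K _ _ => ⟨hGZ N W K, hKo N W K, heegnerPointComplex_mem_range_map_holds N W K⟩, hGZK,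
      hasEntireLFunction_rat_of_exists_isNewformOf hnf⟩
    hZ (rankOneAtTwoBigImageOddLocal_of_kolyvaginExactAtTwo_of_kolyvaginConjecture hGZ hGZK hnf hHL hMilneC hX hMan hKC hZ)

/-- The same with route ByReductionTypeAtTwo's four rank-`0` cruxes at `2` BY NAME (`rankZeroTwin_of_rankZero_cruxes`).
BSD is not proved by this: conditional by design. -/
theorem doorIndexLawFullAtTwo_of_kolyvaginExactAtTwo_of_kolyvaginConjecture_of_rankZero_cruxes
    (hGZ : ∀ (N : ℕ) [NeZero N] (W : WeierstrassCurve ℚ) (K : Type) [Field K] [NumberField K], gross_zagier N W K)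
    (hKo : ∀ (N : ℕ) [NeZero N] (W : WeierstrassCurve ℚ) (K : Type) [Field K] [NumberField K], kolyvagin N W K)
    (hGZK : rank_eq_analyticRank_of_analyticRank_le_one) (hnf : exists_isNewformOf)
    (hHL : HoffsteinLuo1997_exists_twist_L_one_ne_zero) (hMilneC : Milne1972.bsdQuotient_baseChange_quadratic_anyModel)
    (hX : KolyvaginExactAtTwo) (hMan : S_manin)
    (hKC : ∀ (W : WeierstrassCurve ℚ) [W.IsElliptic] [W.IsGloballyMinimal] [NeZero (W.conductorNorm ℤ)],
      ¬ W.HasCM → (∀ n : ℕ, W.HasSurjectiveModNGaloisRep ((2 ^ n : ℕ) : ℤ)) → Odd W.tamagawaProduct → W.analyticRank = 1 →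
      ∀ (K : Type) [Field K] [NumberField K], IsImaginaryQuadratic K → Odd (NumberField.discr K) →
        NumberField.discr K ≠ -3 → SatisfiesHeegnerHypothesis (W.conductorNorm ℤ) K →
        ¬ IsSquare ((NumberField.discr K : ℚ) * -|W.Δ|) → ¬ IsSquare ((NumberField.discr K : ℚ) * (-(2 * |W.Δ|))) →
        ∀ (Dt : ModularParametrizationData W (W.conductorNorm ℤ)) (β : ℤ) (ι : K →+* ℂ) (d₁ : KolyvaginHeegnerData Dt β ι 1),
          Odd Dt.c → ¬ IsOfFinAddOrder d₁.derivedPoint →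
          ∃ (n : ℕ) (d : KolyvaginHeegnerData Dt β ι n), Squarefree n ∧
            (∀ ℓ ∈ n.primeFactors, Zhang2014.IsKolyvaginPrime (W.conductorNorm ℤ) W K 2 ℓ) ∧
            ¬ ∃ Q : (W.baseChange (ringClassField K ι n)).toAffine.Point, (2 : ℤ) • Q = d.derivedPoint)
    (hR0 : GoodOrdinaryRankZeroAtTwo ∧ MultiplicativeRankZeroAtTwo ∧ SupersingularRankZeroAtTwo ∧ AdditiveRankZeroAtTwo) :
    DoorIndexLawFullAtTwo :=
  doorIndexLawFullAtTwo_of_kolyvaginExactAtTwo_of_kolyvaginConjecture hGZ hKo hGZK hnf hHL hMilneC hX hMan hKC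
    (rankZeroTwin_of_rankZero_cruxes hR0)

/-- **The crux from the K-side inputs with the route's four rank-`0` cruxes BY NAME** (`rankZeroTwin_of_rankZero_cruxes`), for the
planner's by-name bookkeeping. BSD is not proved by this: conditional by design. -/
theorem rankOneAtTwoBigImageOddLocal_of_kolyvaginExactAtTwo_of_kolyvaginConjecture_of_rankZero_cruxes
    (hGZ : ∀ (N : ℕ) [NeZero N] (W : WeierstrassCurve ℚ) (K : Type) [Field K] [NumberField K], gross_zagier N W K)
    (hGZK : rank_eq_analyticRank_of_analyticRank_le_one) (hnf : exists_isNewformOf)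
    (hHL : HoffsteinLuo1997_exists_twist_L_one_ne_zero) (hMilneC : Milne1972.bsdQuotient_baseChange_quadratic_anyModel)
    (hX : KolyvaginExactAtTwo) (hMan : S_manin)
    (hKC : ∀ (W : WeierstrassCurve ℚ) [W.IsElliptic] [W.IsGloballyMinimal] [NeZero (W.conductorNorm ℤ)],
      ¬ W.HasCM → (∀ n : ℕ, W.HasSurjectiveModNGaloisRep ((2 ^ n : ℕ) : ℤ)) → Odd W.tamagawaProduct → W.analyticRank = 1 →
      ∀ (K : Type) [Field K] [NumberField K], IsImaginaryQuadratic K → Odd (NumberField.discr K) →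
        NumberField.discr K ≠ -3 → SatisfiesHeegnerHypothesis (W.conductorNorm ℤ) K →
        ¬ IsSquare ((NumberField.discr K : ℚ) * -|W.Δ|) → ¬ IsSquare ((NumberField.discr K : ℚ) * (-(2 * |W.Δ|))) →
        ∀ (Dt : ModularParametrizationData W (W.conductorNorm ℤ)) (β : ℤ) (ι : K →+* ℂ) (d₁ : KolyvaginHeegnerData Dt β ι 1),
          Odd Dt.c → ¬ IsOfFinAddOrder d₁.derivedPoint →
          ∃ (n : ℕ) (d : KolyvaginHeegnerData Dt β ι n), Squarefree n ∧
            (∀ ℓ ∈ n.primeFactors, Zhang2014.IsKolyvaginPrime (W.conductorNorm ℤ) W K 2 ℓ) ∧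
            ¬ ∃ Q : (W.baseChange (ringClassField K ι n)).toAffine.Point, (2 : ℤ) • Q = d.derivedPoint)
    (hR0 : GoodOrdinaryRankZeroAtTwo ∧ MultiplicativeRankZeroAtTwo ∧ SupersingularRankZeroAtTwo ∧ AdditiveRankZeroAtTwo) :
    RankOneAtTwoBigImageOddLocal :=
  rankOneAtTwoBigImageOddLocal_of_kolyvaginExactAtTwo_of_kolyvaginConjecture hGZ hGZK hnf hHL hMilneC hX hMan hKC
    (rankZeroTwin_of_rankZero_cruxes hR0)

end Summit.BirchSwinnertonDyer.BirchSwinnertonDyer.Theorems.RankOneAtTwoOneDoor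

end
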